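import Summits.Langlands.Langlands.Theses.QuarterConductorLadder

/-!
# Route QuarterConductorLadder — Assembly

The assembly item (stmt-Langlands-26828) of the child route `QuarterConductorLadder` (decomp-langlands lens-1 gen 18; refines the shared
belt crux WHS = `TwistControlLadder.WeaklyRegularHullAvatars`, stmt-Langlands-33573, of route-Langlands-TwistControlLadder rev 3 /
route-Langlands-PrimitiveRankLadder) for the Langlands summit:
`QuarterCensusFloor → QuarterCensusBand → QuarterConductorTail → OffQuarterBoxAvatars → WeaklyRegularHullFrame → Langlands`.

This is literally the type of the route file's sorry-free deciding theorem `Summit.Langlands.Langlands.Theses.QuarterConductorLadder.closes`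
(FRAME reduces `Langlands` to WHS; the conductor dial dispatches to QF (N ≤ 880), QB (881–1950), QT (≥ 1951) or QO (off-box)).  Nothing here
proves `Langlands`: the assembly records only that the five ledger items of the route, taken together, imply the summit statement.
-/

set_option linter.dupNamespace false -- project-wide option (lakefile weak.linter.dupNamespace); `Summit.Langlands.Langlands` is the mandated namespace

namespace Summit.Langlands.Langlands.Theorems

/-- **Assembly of route QuarterConductorLadder** (stmt-Langlands-26828): `QF → QB → QT → QO → FRAME → Langlands`.  Proof: unfold `Assembly` and
apply the route's deciding theorem `Theses.QuarterConductorLadder.closes`. -/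
theorem quarterConductorLadder_assembly_proof :
    Summit.Langlands.Langlands.Theses.QuarterConductorLadder.Assembly := by
  unfold Summit.Langlands.Langlands.Theses.QuarterConductorLadder.Assembly
  exact Summit.Langlands.Langlands.Theses.QuarterConductorLadder.closes

end Summit.Langlands.Langlands.Theorems
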